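import Literature.MathematicalPhysics.KineticTheory.VelocityFlipEmbeddedChain
import HarnessLib

/-!
# The embedded flip chain of the pinned chain: Lyapunov bound, an invariant law, the steady state

Trunk T-KINETIC (Literature/MathematicalPhysics/KineticTheory). Theorems only; companion of
`VelocityFlipEmbeddedChain.lean` (the named kernels `resolventKernel`, `flipKernel`,
`embeddedFlipKernel K = Q ∘ₖ R_r` of the velocity-flip model embedded at its flip times, and the
uniqueness of the `K`-invariant probability measure). Here, for the named kernels:

* `LangevinChainSemigroup.integral_generator_resolventKernel` — the resolvent identity
  `∫ Lf dR_r(z, ·) = r (∫ f dR_r(z, ·) - f z)` on `C_c^∞`;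
  `…continuous_integral_resolventKernel`, `…continuous_integral_embeddedFlipKernel` — the Feller
  property of `R_r` and of `K` (`Q` preserves bounded continuous functions);
  `…lintegral_embeddedFlipKernel_of_invariant` — `K W = R_r W` for flip-invariant weights;
* `pinnedChain_lintegral_exp_hamiltonian_resolventKernel_le` — the contracting Lyapunov bound
  `R_r e^{θH} ≤ a e^{θH} + b`, `a < 1`, for the pinned chain (the computation of
  `pinnedChain_exists_resolventKernel`, CEHR Thm 5.1 + (3.4)–(3.6), for the named kernel);
* `pinnedChain_exists_invariant_embeddedFlipKernel` — `K` has an invariant probability measure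
  with `∫ e^{θH} dπ < ∞` (discrete Krylov–Bogoliubov, `MarkovChain.exists_invariant_of_lyapunov`);
* `pinnedChain_isFlipSteadyState_bind_resolventKernel` — for every such `π`, `μ := π R_{Nε}` IS a
  weak flip steady state (`OscillatorChain.IsFlipSteadyState`): `∫ Lf dμ = Nε (μ f - π f)` and
  `ε ∫ Sf dμ = Nε (μ(Qf) - μ f) = Nε (π f - μ f)` cancel (`μ Q = π K = π`), and
  `∫ e^{θH} dμ ≤ a ∫ e^{θH} dπ + b < ∞` makes the bond currents integrable.

Together with `pinnedChain_embeddedFlipKernel_invariant_unique` this leaves, of the uniqueness of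
the weak flip steady state, exactly the identification (U1) "every weak flip steady state is
`π R_{Nε}` for a `K`-invariant `π`" (NOT here).

## References

* C. Bernardin, S. Olla, J. Stat. Phys. 145 (2011) 1224–1255, §2.1 and Prop. 1.
* N. Cuneo, J.-P. Eckmann, M. Hairer, L. Rey-Bellet, Electron. J. Probab. 23 (2018) no. 55, §3
  eq. (3.4)–(3.6), Thm 5.1, Rem 5.2.
* S. N. Ethier, T. G. Kurtz, *Markov Processes* (1986), Ch. 1 §2 (resolvents), Ch. 4 §10.
-/

noncomputable section

open MeasureTheory ProbabilityTheory Filter Topology Set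
open scoped NNReal ENNReal ContDiff BoundedContinuousFunction

namespace Literature.MathematicalPhysics.KineticTheory.HeatConduction

open Literature.Probability.Process OscillatorChain

/-! ### Resolvent identity and Feller property of the named kernels; flip-invariant weights -/

section Flip

variable {N : ℕ}

/-- A flip-invariant weight is `Q`-harmonic: `∫⁻ W dQ(z, ·) = W z` if `W(z^i) = W(z)` for all `i`.
[folklore] -/
theorem lintegral_flipKernel_of_invariant {W : PhaseSpace N → ℝ≥0∞}
    (hW : ∀ (i : Fin N) (x : PhaseSpace N), W (momentumFlip i x) = W x) (z : PhaseSpace N) :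
    ∫⁻ y, W y ∂(flipKernel N z) = W z := by
  rcases Nat.eq_zero_or_pos N with rfl | hN
  · change ∫⁻ y, W y ∂(Kernel.id z) = W z
    rw [Kernel.id_apply, lintegral_dirac]
  · rw [lintegral_flipKernel hN]
    simp only [hW, Finset.sum_const, Finset.card_univ, Fintype.card_fin, nsmul_eq_mul]
    rw [← mul_assoc, ENNReal.inv_mul_cancel (Nat.cast_ne_zero.2 hN.ne') (ENNReal.natCast_ne_top N),
      one_mul]

/-- `Q` maps bounded continuous functions to bounded continuous functions:
`Q g = N⁻¹ ∑_i g ∘ momentumFlip i`. [folklore] -/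
theorem exists_integral_flipKernel_eq (g : PhaseSpace N →ᵇ ℝ) :
    ∃ g' : PhaseSpace N →ᵇ ℝ, ∀ z, ∫ y, g y ∂(flipKernel N z) = g' z := by
  rcases Nat.eq_zero_or_pos N with rfl | hN
  · refine ⟨g, fun z => ?_⟩
    change ∫ y, g y ∂(Kernel.id z) = g z
    rw [Kernel.id_apply, integral_dirac]
  · refine ⟨(N : ℝ)⁻¹ • ∑ i : Fin N, g.compContinuous ⟨momentumFlip i, continuous_momentumFlip i⟩,
      fun z => ?_⟩
    rw [integral_flipKernel hN]
    simp only [BoundedContinuousFunction.coe_smul, BoundedContinuousFunction.coe_sum,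
      Finset.sum_apply, BoundedContinuousFunction.compContinuous_apply, ContinuousMap.coe_mk,
      smul_eq_mul]

/-- The flip noise in terms of `Q`: `∑_i (f(z^i) - f z) = N (Q f)(z) - N f(z)`. [folklore] -/
theorem sum_sub_eq_integral_flipKernel (hN : 0 < N) (f : PhaseSpace N → ℝ) (z : PhaseSpace N) :
    ∑ i : Fin N, (f (momentumFlip i z) - f z) = N * ∫ y, f y ∂(flipKernel N z) - N * f z := by
  rw [integral_flipKernel hN, ← mul_assoc, mul_inv_cancel₀ (Nat.cast_ne_zero.2 hN.ne'), one_mul,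
    Finset.sum_sub_distrib]
  simp only [Finset.sum_const, Finset.card_univ, Fintype.card_fin, nsmul_eq_mul]

end Flip

namespace LangevinChainSemigroup

variable {P : OscillatorChain} {N : ℕ} {T_L T_R : ℝ} (S : LangevinChainSemigroup P N T_L T_R)

/-- **The resolvent identity** `∫ Lf dR_r(z, ·) = r (∫ f dR_r(z, ·) - f z)` on `C_c^∞` (`C¹`
potentials, `r > 0`): `LangevinChainSemigroup.integral_generator_comp_const_prod_id` for the
named kernel. [folklore] -/
theorem integral_generator_resolventKernel (hU : ContDiff ℝ 1 P.U) (hV : ContDiff ℝ 1 P.V)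
    {r : ℝ} (hr : 0 < r) {f : PhaseSpace N → ℝ} (hf : ContDiff ℝ ∞ f) (hfc : HasCompactSupport f)
    (z : PhaseSpace N) :
    ∫ y, P.generator N T_L T_R f y ∂(S.resolventKernel r z) =
      r * (∫ y, f y ∂(S.resolventKernel r z) - f z) :=
  S.integral_generator_comp_const_prod_id S.timeKernel (fun _ _ => rfl) hU hV hr hf hfc z

/-- **Feller property of the resolvent kernel**: if every `P_t` maps bounded continuous functions
to continuous ones, `z ↦ ∫ g dR_r(z, ·)` is continuous for bounded continuous `g`. [folklore] -/
theorem continuous_integral_resolventKernel {r : ℝ} (hr : 0 < r)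
    (hF : ∀ (t : ℝ≥0) (g : PhaseSpace N →ᵇ ℝ), Continuous (S.act t g)) (g : PhaseSpace N →ᵇ ℝ) :
    Continuous fun z => ∫ y, g y ∂(S.resolventKernel r z) := by
  haveI := isProbabilityMeasure_expMeasure hr
  exact S.continuous_integral_comp_const_prod_id S.timeKernel (fun _ _ => rfl) (expMeasure r) hF g

/-- `K W = R_r W` for a flip-invariant weight `W` (e.g. `e^{θH}`, `H(z^i) = H(z)`). [folklore] -/
theorem lintegral_embeddedFlipKernel_of_invariant {r : ℝ} {W : PhaseSpace N → ℝ≥0∞}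
    (hWm : Measurable W) (hW : ∀ (i : Fin N) (x : PhaseSpace N), W (momentumFlip i x) = W x)
    (z : PhaseSpace N) :
    ∫⁻ y, W y ∂(S.embeddedFlipKernel r z) = ∫⁻ y, W y ∂(S.resolventKernel r z) := by
  rw [embeddedFlipKernel_eq, Kernel.lintegral_comp _ _ _ hWm]
  simp_rw [lintegral_flipKernel_of_invariant hW]

/-- **Feller property of the embedded chain**: `K g = R_r (Q g)` with `Q g` bounded continuous.
[folklore] -/
theorem continuous_integral_embeddedFlipKernel {r : ℝ} (hr : 0 < r)
    (hF : ∀ (t : ℝ≥0) (g : PhaseSpace N →ᵇ ℝ), Continuous (S.act t g)) (g : PhaseSpace N →ᵇ ℝ) :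
    Continuous fun z => ∫ y, g y ∂(S.embeddedFlipKernel r z) := by
  haveI := S.isMarkovKernel_resolventKernel hr
  obtain ⟨g', hg'⟩ := exists_integral_flipKernel_eq g
  have heq : (fun z => ∫ y, g y ∂(S.embeddedFlipKernel r z)) =
      fun z => ∫ x, g' x ∂(S.resolventKernel r z) := by
    funext z
    rw [embeddedFlipKernel_eq, Kernel.comp_apply,
      MarkovChain.integral_bind_eq_integral_integral (flipKernel N) (S.resolventKernel r z)
        g.continuous.stronglyMeasurable (fun x => g.norm_coe_le_norm x)]
    exact integral_congr_ae (Eventually.of_forall hg')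
  rw [heq]
  exact S.continuous_integral_resolventKernel hr hF g'

end LangevinChainSemigroup

/-! ### The pinned chain: Lyapunov bound, an invariant law of `K`, and the steady state `π R` -/

section PinnedLyapunov

variable {ω₂ lam β γ : ℝ} {N : ℕ} {T_L T_R : ℝ}

/-- **Contracting Lyapunov bound for the named resolvent kernel of the pinned chain**
(`ω₂, lam, β, γ > 0`, `N ≥ 2`, `T_L, T_R > 0`, `r > 0`, `0 < θ < 1/max(T_L, T_R)`):
`∫ e^{θH} dR_r(z, ·) ≤ a e^{θH(z)} + b` with `a < 1`, `b < ∞`. The computation of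
`pinnedChain_exists_resolventKernel` (`LangevinChainResolvent.lean`) for the named kernel: CEHR
Thm 5.1 (`pinnedChain_lintegral_exp_hamiltonian_small`, contraction `1/2` at
`t* = 1/(8(C + r + 1))`, `C = θγ(T_L + T_R)`), (3.4) on `[0, t*)`, the iteration (3.5)–(3.6), and
the average over the exponential time (`a ≤ e^{Ct*}(r t* + 1/2) < 1`).
[cite: CuneoEckmannHairerReyBellet2018, Thm 5.1, Rem 5.2 and §3 eq. (3.4)–(3.6)] -/
theorem pinnedChain_lintegral_exp_hamiltonian_resolventKernel_le (hω : 0 < ω₂) (hl : 0 < lam)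
    (hβ : 0 < β) (hγ : 0 < γ) (hN : 1 < N) (hTL : 0 < T_L) (hTR : 0 < T_R) {r : ℝ} (hr : 0 < r)
    {θ : ℝ} (hθ : 0 < θ) (hθ' : θ < 1 / max T_L T_R) :
    ∃ a b : ℝ≥0∞, a < 1 ∧ b ≠ ⊤ ∧ ∀ z : PhaseSpace N,
      ∫⁻ y, ENNReal.ofReal (Real.exp (θ * (pinnedChain ω₂ lam β γ).hamiltonian N y))
          ∂((pinnedChainSemigroup hω hl.le hβ.le hγ.le (Nat.zero_lt_of_lt hN) hTL.le
              hTR.le).resolventKernel r z) ≤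
        a * ENNReal.ofReal (Real.exp (θ * (pinnedChain ω₂ lam β γ).hamiltonian N z)) + b := by
  have hN0 : 0 < N := Nat.zero_lt_of_lt hN
  set P := pinnedChain ω₂ lam β γ
  set Sg := pinnedChainSemigroup hω hl.le hβ.le hγ.le hN0 hTL.le hTR.le
  haveI := isProbabilityMeasure_expMeasure hr
  set ρ := expMeasure r
  have hK : ∀ (t : ℝ) (z : PhaseSpace N), Sg.timeKernel (t, z) = Sg.kernel t.toNNReal z :=
    fun t z => rfl
  -- time step `t* = 1/(8(C + r + 1))`, so that `a ≤ e^{C t*} (r t* + 1/2) ≤ (8/7)(5/8) < 1`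
  set Cst : ℝ := θ * γ * (T_L + T_R) with hCst
  have hCst0 : 0 ≤ Cst := by positivity
  set ts : ℝ := 1 / (8 * (Cst + r + 1)) with hts
  have hts0 : 0 < ts := by positivity
  have hkey : (Cst + r + 1) * ts = 1 / 8 := by rw [hts]; field_simp
  have hCts : Cst * ts ≤ 1 / 8 := hkey ▸ mul_le_mul_of_nonneg_right (by linarith) hts0.le
  have hrts : r * ts ≤ 1 / 8 := hkey ▸ mul_le_mul_of_nonneg_right (by linarith) hts0.le
  set tstar : ℝ≥0 := ⟨ts, hts0.le⟩
  have htsco : ((tstar : ℝ≥0) : ℝ) = ts := rfl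
  have hts0' : (0 : ℝ≥0) < tstar := by rw [← NNReal.coe_lt_coe]; exact hts0
  set V : PhaseSpace N → ℝ≥0∞ := fun y => ENNReal.ofReal (Real.exp (θ * P.hamiltonian N y)) with hV
  have hVm : Measurable V := ENNReal.measurable_ofReal.comp (Real.measurable_exp.comp
    ((pinnedChain_continuous_hamiltonian ω₂ lam β γ N).measurable.const_mul _))
  have h34 := lintegral_exp_mul_hamiltonian_pinnedChainSemigroup_le hω hl.le hβ.le hγ.le hN0 hTL.le
    hTR.le hTL hTR hθ hθ'
  -- H2 at `t*` with contraction `1/2` (CEHR Thm 5.1 in the tree; (3.4) below the level `E₀`)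
  obtain ⟨E₀, hE₀⟩ := pinnedChain_lintegral_exp_hamiltonian_small hω hl hβ hγ hN hTL hTR hθ hθ'
    (tstar := (tstar : ℝ)) (by rw [htsco]; exact hts0)
  set c₀ : ℝ := Real.exp (Cst * ts) * Real.exp (θ * E₀) with hc₀
  set a₀ : ℝ≥0∞ := ENNReal.ofReal (1 / 2) with ha₀
  have hH2 : ∀ x, ∫⁻ y, V y ∂(Sg.kernel tstar x) ≤ a₀ * V x + ENNReal.ofReal c₀ := by
    intro x
    change ∫⁻ y, V y ∂(P.transitionKernel N T_L T_R tstar x) ≤ _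
    by_cases hx : P.hamiltonian N x ≤ E₀
    · refine (h34 tstar x).trans (le_add_left (ENNReal.ofReal_le_ofReal ?_))
      rw [hc₀, htsco]
      exact mul_le_mul_of_nonneg_left (Real.exp_le_exp.2 (mul_le_mul_of_nonneg_left hx hθ.le))
        (Real.exp_pos _).le
    · rw [pinnedChain_lintegral_transitionKernel hω hl.le hβ.le hγ.le N T_L T_R tstar x hVm]
      refine (hE₀ x (le_of_not_ge hx)).trans (le_add_right (le_of_eq ?_))
      rw [ha₀, hV, ← ENNReal.ofReal_mul (by norm_num)]
      congr 1; ring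
  set c : ℝ≥0∞ := ENNReal.ofReal (Real.exp (Cst * ts)) with hc
  have hloc : ∀ u : ℝ≥0, u < tstar → ∀ x, ∫⁻ y, V y ∂(Sg.kernel u x) ≤ c * V x := by
    intro u hu x
    refine (h34 u x).trans ?_
    rw [hc, hV, ← ENNReal.ofReal_mul (by positivity)]
    refine ENNReal.ofReal_le_ofReal (mul_le_mul_of_nonneg_right (Real.exp_le_exp.2 ?_) (by positivity))
    have hu' : ((u : ℝ≥0) : ℝ) ≤ ts := by rw [← htsco]; exact_mod_cast hu.le
    rw [hCst]
    nlinarith [u.coe_nonneg]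
  -- the uniform orbit bound (3.5)–(3.6), and its sharpening past `t*`
  have ha₀1 : a₀ < 1 := ENNReal.ofReal_lt_one.2 (by norm_num)
  obtain ⟨B, hBtop, hB⟩ := MarkovSemigroup.exists_fixedBound ha₀1 ENNReal.ofReal_ne_top
  have hunif : ∀ (t : ℝ≥0) x, ∫⁻ y, V y ∂(Sg.kernel t x) ≤ c * V x + B := fun t x =>
    MarkovSemigroup.lintegral_kernel_le_of_lyapunov Sg.kernel Sg.kernel_zero Sg.kernel_add hVm hts0'
      ha₀1.le hB hH2 hloc t x
  refine ⟨c * ENNReal.ofReal (r * ts) + c * a₀, B + (c * ENNReal.ofReal c₀ + B), ?_, ?_,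
    fun z => ?_⟩
  · rw [hc, ha₀, ← ENNReal.ofReal_mul (Real.exp_pos _).le,
      ← ENNReal.ofReal_mul (Real.exp_pos _).le, ← ENNReal.ofReal_add (by positivity) (by positivity),
      ENNReal.ofReal_lt_one]
    have h1 : Real.exp (Cst * ts) * (1 - Cst * ts) ≤ 1 := by
      have := Real.add_one_le_exp (-(Cst * ts))
      calc Real.exp (Cst * ts) * (1 - Cst * ts)
          ≤ Real.exp (Cst * ts) * Real.exp (-(Cst * ts)) :=
            mul_le_mul_of_nonneg_left (by linarith) (Real.exp_pos _).le
        _ = 1 := by rw [← Real.exp_add, add_neg_cancel, Real.exp_zero]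
    nlinarith [Real.exp_pos (Cst * ts), mul_nonneg hCst0 hts0.le, mul_nonneg hr.le hts0.le]
  · exact ENNReal.add_ne_top.2 ⟨hBtop, ENNReal.add_ne_top.2
      ⟨ENNReal.mul_ne_top ENNReal.ofReal_ne_top ENNReal.ofReal_ne_top, hBtop⟩⟩
  · have h₁ : ∀ t : ℝ, ∫⁻ y, V y ∂(Sg.timeKernel (t, z)) ≤ c * V z + B := fun t =>
      hunif t.toNNReal z
    have h₂ : ∀ t : ℝ, ts ≤ t →
        ∫⁻ y, V y ∂(Sg.timeKernel (t, z)) ≤ c * a₀ * V z + (c * ENNReal.ofReal c₀ + B) :=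
      fun t ht => Sg.lintegral_kernel_le_of_tstar_le Sg.timeKernel hK hVm hH2 hunif
        (by rw [htsco]; exact ht) z
    rw [LangevinChainSemigroup.resolventKernel_eq]
    refine (lintegral_comp_const_prod_id_le Sg.timeKernel ρ z hVm ts h₁ h₂).trans ?_
    gcongr
    exact expMeasure_Iio_le hr hts0.le

/-- **The embedded flip chain of the pinned chain has an invariant probability measure with an
exponential moment** (`ω₂, lam, β, γ > 0`, `N ≥ 2`, `T_L, T_R > 0`, `r > 0`,
`0 < θ < 1/max(T_L, T_R)`): `∃ π`, `π K = π`, `∫ e^{θH} dπ < ∞`. Discrete Krylov–Bogoliubov /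
Foster–Lyapunov (`MarkovChain.exists_invariant_of_lyapunov`): `K` is Feller
(`continuous_integral_embeddedFlipKernel`, `continuous_act_pinnedChainSemigroup`) and
`K e^{θH} = R_r e^{θH} ≤ a e^{θH} + b` (`hamiltonian_momentumFlip`,
`pinnedChain_lintegral_exp_hamiltonian_resolventKernel_le`), `e^{θH}` having compact sublevel sets.
[cite: BernardinOlla2011, Prop. 1] -/
theorem pinnedChain_exists_invariant_embeddedFlipKernel (hω : 0 < ω₂) (hl : 0 < lam) (hβ : 0 < β)
    (hγ : 0 < γ) (hN : 1 < N) (hTL : 0 < T_L) (hTR : 0 < T_R) {r : ℝ} (hr : 0 < r) {θ : ℝ}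
    (hθ : 0 < θ) (hθ' : θ < 1 / max T_L T_R) :
    ∃ π : Measure (PhaseSpace N), IsProbabilityMeasure π ∧
      Kernel.Invariant ((pinnedChainSemigroup hω hl.le hβ.le hγ.le (Nat.zero_lt_of_lt hN) hTL.le
        hTR.le).embeddedFlipKernel r) π ∧
      ∫⁻ x, ENNReal.ofReal (Real.exp (θ * (pinnedChain ω₂ lam β γ).hamiltonian N x)) ∂π < ⊤ := by
  have hN0 : 0 < N := Nat.zero_lt_of_lt hN
  set P := pinnedChain ω₂ lam β γ
  set Sg := pinnedChainSemigroup hω hl.le hβ.le hγ.le hN0 hTL.le hTR.le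
  haveI := Sg.isMarkovKernel_embeddedFlipKernel hr
  obtain ⟨a, b, ha, hb, hlyap⟩ :=
    pinnedChain_lintegral_exp_hamiltonian_resolventKernel_le hω hl hβ hγ hN hTL hTR hr hθ hθ'
  let V : PhaseSpace N → ℝ≥0 := fun x => (Real.exp (θ * P.hamiltonian N x)).toNNReal
  have hVcont : Continuous V := continuous_real_toNNReal.comp (Real.continuous_exp.comp
    (continuous_const.mul (pinnedChain_continuous_hamiltonian ω₂ lam β γ N)))
  have hVflip : ∀ (i : Fin N) (x : PhaseSpace N), (V (momentumFlip i x) : ℝ≥0∞) = V x := by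
    intro i x
    simp only [V, OscillatorChain.hamiltonian_momentumFlip]
  have hKlyap : ∀ z, ∫⁻ y, (V y : ℝ≥0∞) ∂(Sg.embeddedFlipKernel r z) ≤ a * V z + b := fun z => by
    rw [Sg.lintegral_embeddedFlipKernel_of_invariant (W := fun y => (V y : ℝ≥0∞))
      (measurable_coe_nnreal_ennreal.comp hVcont.measurable) hVflip z]
    exact hlyap z
  obtain ⟨π, hπ, hinv, hVfin⟩ := MarkovChain.exists_invariant_of_lyapunov (Sg.embeddedFlipKernel r)
    (Sg.continuous_integral_embeddedFlipKernel hr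
      (continuous_act_pinnedChainSemigroup hω hl.le hβ.le hγ.le hN0 hTL.le hTR.le))
    V hVcont (fun R => pinnedChain_isCompact_setOf_exp_le hω hl.le hβ.le γ N hθ R) ha hb hKlyap 0
  exact ⟨π, hπ, hinv, hVfin⟩

/-- **Invariant laws of the embedded chain give weak flip steady states** (pinned chain,
`ω₂, lam, β, γ > 0`, `N ≥ 2`, `T_L, T_R > 0`, `ε > 0`): if `π` is a probability measure with
`π K = π` for `K = Q ∘ₖ R_{Nε}` and `∫ e^{θH} dπ < ∞` for some `0 < θ < 1/max(T_L, T_R)`, then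
`μ := π R_{Nε}` is a weak flip steady state (`OscillatorChain.IsFlipSteadyState`): for
`f ∈ C_c^∞`, `∫ Lf dμ = Nε (μ f - π f)` (`integral_generator_resolventKernel`) and
`ε ∫ Sf dμ = Nε (μ(Qf) - μ f) = Nε (π f - μ f)` (`μ Q = π K = π`) cancel, and
`∫ e^{θH} dμ ≤ a ∫ e^{θH} dπ + b < ∞` makes the bond currents integrable. The named-kernel
form of `exists_isFlipSteadyState_of_resolventKernel`. [cite: BernardinOlla2011, Prop. 1] -/
theorem pinnedChain_isFlipSteadyState_bind_resolventKernel (hω : 0 < ω₂) (hl : 0 < lam)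
    (hβ : 0 < β) (hγ : 0 < γ) (hN : 1 < N) (hTL : 0 < T_L) (hTR : 0 < T_R) {ε : ℝ} (hε : 0 < ε)
    {θ : ℝ} (hθ : 0 < θ) (hθ' : θ < 1 / max T_L T_R) (π : Measure (PhaseSpace N))
    [IsProbabilityMeasure π]
    (hinv : Kernel.Invariant ((pinnedChainSemigroup hω hl.le hβ.le hγ.le (Nat.zero_lt_of_lt hN)
      hTL.le hTR.le).embeddedFlipKernel (N * ε)) π)
    (hfin : ∫⁻ x, ENNReal.ofReal (Real.exp (θ * (pinnedChain ω₂ lam β γ).hamiltonian N x)) ∂π < ⊤) :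
    (pinnedChain ω₂ lam β γ).IsFlipSteadyState N T_L T_R ε
      (π.bind ((pinnedChainSemigroup hω hl.le hβ.le hγ.le (Nat.zero_lt_of_lt hN) hTL.le
        hTR.le).resolventKernel (N * ε))) := by
  have hN0 : 0 < N := Nat.zero_lt_of_lt hN
  have hNR : (N : ℝ) ≠ 0 := Nat.cast_ne_zero.2 hN0.ne'
  have hr : (0 : ℝ) < N * ε := by positivity
  set P := pinnedChain ω₂ lam β γ with hP
  set Sg := pinnedChainSemigroup hω hl.le hβ.le hγ.le hN0 hTL.le hTR.le
  set R := Sg.resolventKernel (N * ε) with hRdef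
  haveI : IsMarkovKernel R := Sg.isMarkovKernel_resolventKernel hr
  have hbdd_int {g : PhaseSpace N → ℝ} (hg : Continuous g) {C : ℝ} (hC : ∀ x, ‖g x‖ ≤ C)
      (ν : Measure (PhaseSpace N)) [IsFiniteMeasure ν] : Integrable g ν :=
    (integrable_const C).mono' hg.aestronglyMeasurable (Eventually.of_forall hC)
  have hbindQ : (π.bind R).bind (flipKernel N) = π := Measure.comp_assoc.trans hinv.def
  have hfeller : ∀ g : PhaseSpace N →ᵇ ℝ, Continuous fun z => ∫ y, g y ∂(R z) := fun g =>
    Sg.continuous_integral_resolventKernel hr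
      (continuous_act_pinnedChainSemigroup hω hl.le hβ.le hγ.le hN0 hTL.le hTR.le) g
  unfold OscillatorChain.IsFlipSteadyState
  refine ⟨inferInstance, fun f hf hfc => ?_, fun i => ?_⟩
  · -- the weak equation `∫ (L f + ε S f) d(π R) = 0`
    have hf2 : ContDiff ℝ 2 f := hf.of_le (by norm_cast)
    have hLc : Continuous (P.generator N T_L T_R f) :=
      P.continuous_generator (pinnedChain_contDiff_U ω₂ lam β γ) (pinnedChain_contDiff_V ω₂ lam β γ)
        N T_L T_R hf2
    obtain ⟨CL, hCL⟩ := P.exists_bound_generator (pinnedChain_contDiff_U ω₂ lam β γ)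
      (pinnedChain_contDiff_V ω₂ lam β γ) N T_L T_R hf2 hfc
    obtain ⟨Cf, hCf⟩ : ∃ C, ∀ x, ‖f x‖ ≤ C := hf.continuous.bounded_above_of_compact_support hfc
    have hRf_cont : Continuous fun z => ∫ y, f y ∂(R z) := by
      simpa using hfeller (BoundedContinuousFunction.ofNormedAddCommGroup f hf.continuous Cf hCf)
    have hRf_bd : ∀ z, ‖∫ y, f y ∂(R z)‖ ≤ Cf := fun z => by
      simpa using norm_integral_le_of_norm_le_const (μ := R z) (Eventually.of_forall hCf)
    have hQf_cont : Continuous fun x => ∫ y, f y ∂(flipKernel N x) := by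
      simp_rw [integral_flipKernel hN0]
      exact continuous_const.mul
        (continuous_finsetSum _ fun i _ => hf.continuous.comp (continuous_momentumFlip i))
    have hQf_bd : ∀ x, ‖∫ y, f y ∂(flipKernel N x)‖ ≤ Cf := fun x => by
      simpa using norm_integral_le_of_norm_le_const (μ := flipKernel N x) (Eventually.of_forall hCf)
    have hμf : ∫ x, f x ∂(π.bind R) = ∫ z, ∫ y, f y ∂(R z) ∂π :=
      MarkovChain.integral_bind_eq_integral_integral R π hf.continuous.stronglyMeasurable hCf
    -- generator part (resolvent identity): `∫ L f d(π R) = N ε (∫ f d(π R) - ∫ f dπ)`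
    have h1 : ∫ x, P.generator N T_L T_R f x ∂(π.bind R) =
        (N * ε) * (∫ x, f x ∂(π.bind R) - ∫ x, f x ∂π) := by
      rw [MarkovChain.integral_bind_eq_integral_integral R π hLc.stronglyMeasurable hCL]
      have hres : ∀ z, ∫ y, P.generator N T_L T_R f y ∂(R z) = (N * ε) * (∫ y, f y ∂(R z) - f z) :=
        fun z => Sg.integral_generator_resolventKernel (pinnedChain_contDiff_U ω₂ lam β γ)
          (pinnedChain_contDiff_V ω₂ lam β γ) hr hf hfc z
      simp_rw [hres]
      rw [integral_const_mul, integral_sub (hbdd_int hRf_cont hRf_bd π)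
        (hbdd_int hf.continuous hCf π), hμf]
    -- flip part (invariance of `π` under `Q ∘ₖ R`): `∫ S f d(π R) = N (∫ f dπ - ∫ f d(π R))`
    have hA : Integrable (fun x => (N : ℝ) * ∫ y, f y ∂(flipKernel N x)) (π.bind R) :=
      (hbdd_int hQf_cont hQf_bd _).const_mul _
    have hB : Integrable (fun x => (N : ℝ) * f x) (π.bind R) :=
      (hbdd_int hf.continuous hCf _).const_mul _
    have hS : Integrable (fun x => ∑ i : Fin N, (f (momentumFlip i x) - f x)) (π.bind R) := by
      simp_rw [sum_sub_eq_integral_flipKernel hN0]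
      exact hA.sub hB
    have h2 : ∫ x, (∑ i : Fin N, (f (momentumFlip i x) - f x)) ∂(π.bind R) =
        N * (∫ x, f x ∂π - ∫ x, f x ∂(π.bind R)) := by
      simp_rw [sum_sub_eq_integral_flipKernel hN0]
      rw [integral_sub hA hB, integral_const_mul, integral_const_mul,
        ← MarkovChain.integral_bind_eq_integral_integral (flipKernel N) (π.bind R)
          hf.continuous.stronglyMeasurable hCf, hbindQ]
      ring
    simp only [OscillatorChain.flipGenerator_apply]
    rw [integral_add (hbdd_int hLc hCL _) (hS.const_mul ε), integral_const_mul, h1, h2]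
    ring
  · -- integrable bond currents, from `∫⁻ e^{θH} d(π R) ≤ a ∫⁻ e^{θH} dπ + b < ⊤`
    obtain ⟨a, b, ha, hb, hlyap⟩ :=
      pinnedChain_lintegral_exp_hamiltonian_resolventKernel_le hω hl hβ hγ hN hTL hTR hr hθ hθ'
    have hVm : Measurable fun x => ENNReal.ofReal (Real.exp (θ * P.hamiltonian N x)) :=
      ENNReal.measurable_ofReal.comp (Real.measurable_exp.comp
        ((pinnedChain_continuous_hamiltonian ω₂ lam β γ N).measurable.const_mul _))
    refine pinnedChain_integrable_bondCurrent_of_integrable_exp hω.le hl.le hβ.le γ N hθ ?_ i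
    refine ⟨(Real.continuous_exp.comp (continuous_const.mul
      (pinnedChain_continuous_hamiltonian ω₂ lam β γ N))).aestronglyMeasurable, ?_⟩
    show ∫⁻ x, ‖Real.exp (θ * P.hamiltonian N x)‖ₑ ∂(π.bind R) < ⊤
    simp only [Real.enorm_eq_ofReal (Real.exp_nonneg _)]
    calc ∫⁻ x, ENNReal.ofReal (Real.exp (θ * P.hamiltonian N x)) ∂(π.bind R)
        ≤ a * ∫⁻ x, ENNReal.ofReal (Real.exp (θ * P.hamiltonian N x)) ∂π + b * π Set.univ :=
          MarkovChain.lintegral_bind_le_of_lyapunov R hVm hlyap π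
      _ < ⊤ := by
          rw [measure_univ, mul_one]
          exact ENNReal.add_lt_top.2 ⟨ENNReal.mul_lt_top (ha.trans_le le_top) hfin, hb.lt_top⟩

end PinnedLyapunov

end Literature.MathematicalPhysics.KineticTheory.HeatConduction
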